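import Summits.ResolutionOfSingularities.ResolutionOfSingularities.Theorems.FrobeniusLadderFInjectiveMacaulayficationCertifiedChartCentre
import Summits.ResolutionOfSingularities.ResolutionOfSingularities.Theorems.FrobeniusLadderFInjectiveMacaulayficationIsoLocusTransport
import Summits.ResolutionOfSingularities.ResolutionOfSingularities.Theorems.FrobeniusLadderFInjectiveMacaulayficationBadMaximalPoints
import Summits.ResolutionOfSingularities.ResolutionOfSingularities.Theorems.FrobeniusLadderFInjectiveMacaulayficationLocallyFixableCore
import Literature.AlgebraicGeometry.Resolution.BlowupsIntegral
import Summits.ResolutionOfSingularities.ResolutionOfSingularities.Theorems.FrobeniusLadderFInjectiveMacaulayficationSequentialSurgeryGlueOfClass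
import Mathlib.Algebra.CharP.Algebra
import HarnessLib

/-!
# §5α T-𝒫-loc — THE LOCALLY-FIXABLE CLASS `P_locα` (CHART FORM) AND THEOREM A-locα (crux `FInjectiveMacaulayfication`, chain w45a)

Support file for crux stmt-ResolutionOfSingularities-15315 (`FrobeniusLadder.FInjectiveMacaulayfication`), chain w45a, seat
res-L1-w45a-stub-1. [OURS · L1 W4.5a] — NOT a statement of the manuscript under review; AI-written, weaker than expert review.
RULINGS R11.2 / R11.14 of res-L1-w45a-plan-1 (2026-08-27): the point-fixable class in CHART FORM `P_locα` — statements of record =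
`L/res-L1-w45a-stub-1/g3-LocallyFixable-draft.lean` sha16 424b4d2281bd594a (the P-text of its ll.41–48, folded byte-for-byte into
`L/w45a/ClassGlueSig.lean` v4 §5α); the RING-LOCAL form `PFix(𝒪_b)` (ClassGlueSig v3 74b6a04e74c75940 §5) stays the class of
record for the residual target 5e and is bridged to `P_locα` by 5g (separate file).

`P_locα X₁ f₁ b`: inside EVERY open `W ∋ b` there is an affine open `U ∋ b`, `U ≤ W`, on which `b` is the only bad point, with
`char Γ(X₁, U) = p` and an ideal `I ≠ 0` of `Γ(X₁, U)` whose zero locus is `{b}` (`I ≤ 𝔭_x ↔ x = b` on `U`) such that EVERY stalk of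
the affine blowing up `Bl_I(U) = affineBlowup I` at a point over `b` is a domain, Cohen–Macaulay, with Frobenius-closed parameter
ideals (the crux's full clause, inline). No certificates, no engine format.

* §5aα `locallyFixable_h4` — hypothesis (ii) of G-β-rel (`SequentialSurgeryGlueOfClass.sequentialSurgeryGlueOfClass`, p505685) for
  `P := P_locα`: the point-centre of `I` (`LocallyFixable.pointCentre_of_localBlowupClause`, p509687) is a closed centre;
* §5bα `locallyFixable_transport` — hypothesis (iii): the class moves along blowing ups off the centre (proof of
  `CertifiedChartTransport.certifiedChartClass_transport` p507329 with the certificate transport replaced by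
  `LocallyFixable.affineBlowupClause_transport`);
* §5dα `certifiedChart_locallyFixable` — `P_cert ⇒ P_locα` (§2a `CertifiedChartCentre.affineBlowupStalkClauseOfCover` +
  `LocallyFixable.clauseOff_of_zeroLocus`), so §4a THEOREM A factors through §5cα;
* §5cα `fInjectiveMacaulayfication_of_locallyFixable` — THEOREM A-locα: every admissible pair ALL of whose bad points are locally
  fixable has the crux's model (G-β-rel applied to `P_locα` with (ii) := §5aα, (iii) := §5bα; zero named facts).

No definitions, no named facts, no `sorry`. [folklore]
-/

-- single-problem summit: the doubled namespace component is forced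
set_option linter.dupNamespace false

noncomputable section

namespace Summit.ResolutionOfSingularities.ResolutionOfSingularities.Theorems.FInjectiveMacaulayfication.LocallyFixable

open AlgebraicGeometry CategoryTheory Literature.AlgebraicGeometry.Resolution TopologicalSpace
open Summit.ResolutionOfSingularities.ResolutionOfSingularities.Theorems.FInjectiveMacaulayfication

/-! ## §5a Closed centres exist on the locally-fixable class -/

/-- **§5a — CLOSED CENTRES EXIST ON THE LOCALLY-FIXABLE CLASS** (hypothesis (ii) of G-β-rel
`SequentialSurgeryGlueOfClass.sequentialSurgeryGlueOfClass` for `P := P_loc`): at a bad closed point `b` of an admissible pair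
carrying, inside every open neighbourhood, an affine chart `U ∋ b` with an ideal `I ≠ 0` of zero locus `{b}` all of whose affine
blowing-up stalks over `b` satisfy the full clause, SOME ideal sheaf `J ≠ ⊥` with `b ∈ supp J` has all its blowing ups satisfying
the full clause over `supp J`: the point-centre of `I` (`pointCentre_of_localBlowupClause`, `supp J = {b}`; `X₁` is locally
Noetherian by `ClosedPointsOfClosedFinite.isNoetherian_of_locallyOfFiniteType_of_quasiCompact`). [folklore] -/
theorem locallyFixable_h4 : ∀ (p : ℕ), p.Prime → ∀ (k : Type) [Field k] [CharP k p]
    (X₁ : Scheme.{0}) (f₁ : X₁ ⟶ Spec (.of k)),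
      IsSeparated f₁ → LocallyOfFiniteType f₁ → QuasiCompact f₁ → IsIntegral X₁ →
      (∀ x : X₁, ∀ d : ℕ, ringKrullDim (X₁.presheaf.stalk x) = d → ∀ s : Fin d → X₁.presheaf.stalk x, (Ideal.span (Set.range s)).radical.IsMaximal → RingTheory.Sequence.IsWeaklyRegular (X₁.presheaf.stalk x) (List.ofFn s)) →
      Set.Finite {x : X₁ | ¬ ∀ d : ℕ, ringKrullDim (X₁.presheaf.stalk x) = d → ∀ s : Fin d → X₁.presheaf.stalk x, (Ideal.span (Set.range s)).radical.IsMaximal → ∀ y : X₁.presheaf.stalk x, (∃ e : ℕ, y ^ p ^ e ∈ Ideal.span ((fun z : X₁.presheaf.stalk x => z ^ p ^ e) '' (Ideal.span (Set.range s) : Set (X₁.presheaf.stalk x)))) → y ∈ Ideal.span (Set.range s)} →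
      ∀ b : X₁, IsClosed ({b} : Set X₁) → (¬ ∀ d : ℕ, ringKrullDim (X₁.presheaf.stalk b) = d → ∀ s : Fin d → X₁.presheaf.stalk b, (Ideal.span (Set.range s)).radical.IsMaximal → ∀ y : X₁.presheaf.stalk b, (∃ e : ℕ, y ^ p ^ e ∈ Ideal.span ((fun z : X₁.presheaf.stalk b => z ^ p ^ e) '' (Ideal.span (Set.range s) : Set (X₁.presheaf.stalk b)))) → y ∈ Ideal.span (Set.range s)) →
      (∀ W : X₁.Opens, b ∈ W → ∃ U : X₁.affineOpens, (U : X₁.Opens) ≤ W ∧ b ∈ (U : X₁.Opens) ∧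
        (∀ x : X₁, x ∈ (U : X₁.Opens) → x ≠ b → ∀ d : ℕ, ringKrullDim (X₁.presheaf.stalk x) = d → ∀ s : Fin d → X₁.presheaf.stalk x, (Ideal.span (Set.range s)).radical.IsMaximal → ∀ y : X₁.presheaf.stalk x, (∃ e : ℕ, y ^ p ^ e ∈ Ideal.span ((fun z : X₁.presheaf.stalk x => z ^ p ^ e) '' (Ideal.span (Set.range s) : Set (X₁.presheaf.stalk x)))) → y ∈ Ideal.span (Set.range s)) ∧
        CharP Γ(X₁, U) p ∧ ∃ (I : Ideal Γ(X₁, U)), I ≠ ⊥ ∧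
        (∀ (x : X₁) (hx : x ∈ (U : X₁.Opens)), I ≤ (U.2.primeIdealOf ⟨x, hx⟩).asIdeal ↔ x = b) ∧
        ∀ y : ↥(affineBlowup I), (affineBlowup.π I ≫ U.2.fromSpec).base y = b →
          IsDomain ((affineBlowup I).presheaf.stalk y) ∧ ∀ d : ℕ, ringKrullDim ((affineBlowup I).presheaf.stalk y) = d → ∀ s : Fin d → (affineBlowup I).presheaf.stalk y, (Ideal.span (Set.range s)).radical.IsMaximal → RingTheory.Sequence.IsWeaklyRegular ((affineBlowup I).presheaf.stalk y) (List.ofFn s) ∧ ∀ z : (affineBlowup I).presheaf.stalk y, (∃ e : ℕ, z ^ p ^ e ∈ Ideal.span ((fun w : (affineBlowup I).presheaf.stalk y => w ^ p ^ e) '' (Ideal.span (Set.range s) : Set ((affineBlowup I).presheaf.stalk y)))) → z ∈ Ideal.span (Set.range s)) →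
      ∃ J : X₁.IdealSheafData, J ≠ ⊥ ∧ b ∈ (J.support : Set X₁) ∧
        ∀ (X' : Scheme.{0}) (π : X' ⟶ X₁), Literature.AlgebraicGeometry.Resolution.IsBlowup π J →
          ∀ x' : X', π.base x' ∈ (J.support : Set X₁) → IsDomain (X'.presheaf.stalk x') ∧ ∀ d : ℕ, ringKrullDim (X'.presheaf.stalk x') = d → ∀ s : Fin d → X'.presheaf.stalk x', (Ideal.span (Set.range s)).radical.IsMaximal → RingTheory.Sequence.IsWeaklyRegular (X'.presheaf.stalk x') (List.ofFn s) ∧ ∀ y : X'.presheaf.stalk x', (∃ e : ℕ, y ^ p ^ e ∈ Ideal.span ((fun z : X'.presheaf.stalk x' => z ^ p ^ e) '' (Ideal.span (Set.range s) : Set (X'.presheaf.stalk x')))) → y ∈ Ideal.span (Set.range s) := by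
  intro p hp k _ _ X₁ f₁ _ hft hqc hint _ _ b hb _ hP
  haveI : IsNoetherian X₁ := ClosedPointsOfClosedFinite.isNoetherian_of_locallyOfFiniteType_of_quasiCompact f₁
  -- a locally-fixable chart around `b` (inside `W = ⊤`)
  obtain ⟨U, -, hbU, -, -, I, hI0, hzero, hloc⟩ := hP ⊤ trivial
  obtain ⟨J, hJ0, hsupp, hgood⟩ := pointCentre_of_localBlowupClause p X₁ b hb U hbU I hI0 hzero hloc
  refine ⟨J, hJ0, ?_, fun X' π hπ x' hx' => hgood X' π hπ x' ?_⟩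
  · rw [hsupp]; exact Set.mem_singleton b
  · rw [hsupp] at hx'; exact Set.mem_singleton_iff.mp hx'

/-! ## §5b The locally-fixable class transports along blowing ups off the centre -/

/-- **§5b — THE LOCALLY-FIXABLE CLASS TRANSPORTS ALONG BLOWING UPS OFF THE CENTRE** (hypothesis (iii) of G-β-rel for
`P := P_loc`): if `π : X' ⟶ X₁` is a blowing up along `J ≠ ⊥` and `π x' ∉ supp J`, a locally-fixable chart inside
`W ∩ (X₁ ∖ supp J)` around `π x'` pulls back isomorphically to one around `x'` inside any prescribed `W' ∋ x'` — the proof of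
`CertifiedChartTransport.certifiedChartClass_transport` (p507329) with the certificate transport replaced by the transport of the
local blow-up clause along the ring isomorphism `π^* : Γ(X₁, U) ≅ Γ(X', π⁻¹U)` (`affineBlowupClause_transport`). [folklore] -/
theorem locallyFixable_transport : ∀ (p : ℕ), p.Prime → ∀ (k : Type) [Field k] [CharP k p]
    (X₁ : Scheme.{0}) (f₁ : X₁ ⟶ Spec (.of k)),
      IsSeparated f₁ → LocallyOfFiniteType f₁ → QuasiCompact f₁ → IsIntegral X₁ →
      (∀ x : X₁, ∀ d : ℕ, ringKrullDim (X₁.presheaf.stalk x) = d → ∀ s : Fin d → X₁.presheaf.stalk x, (Ideal.span (Set.range s)).radical.IsMaximal → RingTheory.Sequence.IsWeaklyRegular (X₁.presheaf.stalk x) (List.ofFn s)) →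
      Set.Finite {x : X₁ | ¬ ∀ d : ℕ, ringKrullDim (X₁.presheaf.stalk x) = d → ∀ s : Fin d → X₁.presheaf.stalk x, (Ideal.span (Set.range s)).radical.IsMaximal → ∀ y : X₁.presheaf.stalk x, (∃ e : ℕ, y ^ p ^ e ∈ Ideal.span ((fun z : X₁.presheaf.stalk x => z ^ p ^ e) '' (Ideal.span (Set.range s) : Set (X₁.presheaf.stalk x)))) → y ∈ Ideal.span (Set.range s)} →
      ∀ (J : X₁.IdealSheafData), J ≠ ⊥ → ∀ (X' : Scheme.{0}) (π : X' ⟶ X₁), Literature.AlgebraicGeometry.Resolution.IsBlowup π J →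
        ∀ x' : X', π.base x' ∉ (J.support : Set X₁) →
        (∀ W : X₁.Opens, (π.base x') ∈ W → ∃ U : X₁.affineOpens, (U : X₁.Opens) ≤ W ∧ (π.base x') ∈ (U : X₁.Opens) ∧
        (∀ x : X₁, x ∈ (U : X₁.Opens) → x ≠ (π.base x') → ∀ d : ℕ, ringKrullDim (X₁.presheaf.stalk x) = d → ∀ s : Fin d → X₁.presheaf.stalk x, (Ideal.span (Set.range s)).radical.IsMaximal → ∀ y : X₁.presheaf.stalk x, (∃ e : ℕ, y ^ p ^ e ∈ Ideal.span ((fun z : X₁.presheaf.stalk x => z ^ p ^ e) '' (Ideal.span (Set.range s) : Set (X₁.presheaf.stalk x)))) → y ∈ Ideal.span (Set.range s)) ∧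
        CharP Γ(X₁, U) p ∧ ∃ (I : Ideal Γ(X₁, U)), I ≠ ⊥ ∧
        (∀ (x : X₁) (hx : x ∈ (U : X₁.Opens)), I ≤ (U.2.primeIdealOf ⟨x, hx⟩).asIdeal ↔ x = (π.base x')) ∧
        ∀ y : ↥(affineBlowup I), (affineBlowup.π I ≫ U.2.fromSpec).base y = (π.base x') →
          IsDomain ((affineBlowup I).presheaf.stalk y) ∧ ∀ d : ℕ, ringKrullDim ((affineBlowup I).presheaf.stalk y) = d → ∀ s : Fin d → (affineBlowup I).presheaf.stalk y, (Ideal.span (Set.range s)).radical.IsMaximal → RingTheory.Sequence.IsWeaklyRegular ((affineBlowup I).presheaf.stalk y) (List.ofFn s) ∧ ∀ z : (affineBlowup I).presheaf.stalk y, (∃ e : ℕ, z ^ p ^ e ∈ Ideal.span ((fun w : (affineBlowup I).presheaf.stalk y => w ^ p ^ e) '' (Ideal.span (Set.range s) : Set ((affineBlowup I).presheaf.stalk y)))) → z ∈ Ideal.span (Set.range s)) →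
        (∀ W : X'.Opens, x' ∈ W → ∃ U : X'.affineOpens, (U : X'.Opens) ≤ W ∧ x' ∈ (U : X'.Opens) ∧
        (∀ x : X', x ∈ (U : X'.Opens) → x ≠ x' → ∀ d : ℕ, ringKrullDim (X'.presheaf.stalk x) = d → ∀ s : Fin d → X'.presheaf.stalk x, (Ideal.span (Set.range s)).radical.IsMaximal → ∀ y : X'.presheaf.stalk x, (∃ e : ℕ, y ^ p ^ e ∈ Ideal.span ((fun z : X'.presheaf.stalk x => z ^ p ^ e) '' (Ideal.span (Set.range s) : Set (X'.presheaf.stalk x)))) → y ∈ Ideal.span (Set.range s)) ∧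
        CharP Γ(X', U) p ∧ ∃ (I : Ideal Γ(X', U)), I ≠ ⊥ ∧
        (∀ (x : X') (hx : x ∈ (U : X'.Opens)), I ≤ (U.2.primeIdealOf ⟨x, hx⟩).asIdeal ↔ x = x') ∧
        ∀ y : ↥(affineBlowup I), (affineBlowup.π I ≫ U.2.fromSpec).base y = x' →
          IsDomain ((affineBlowup I).presheaf.stalk y) ∧ ∀ d : ℕ, ringKrullDim ((affineBlowup I).presheaf.stalk y) = d → ∀ s : Fin d → (affineBlowup I).presheaf.stalk y, (Ideal.span (Set.range s)).radical.IsMaximal → RingTheory.Sequence.IsWeaklyRegular ((affineBlowup I).presheaf.stalk y) (List.ofFn s) ∧ ∀ z : (affineBlowup I).presheaf.stalk y, (∃ e : ℕ, z ^ p ^ e ∈ Ideal.span ((fun w : (affineBlowup I).presheaf.stalk y => w ^ p ^ e) '' (Ideal.span (Set.range s) : Set ((affineBlowup I).presheaf.stalk y)))) → z ∈ Ideal.span (Set.range s)) := by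
  intro p hp k _ _ X₁ f₁ _ _ _ _ _ _ J _ X' π hπ x' hx' hP W' hxW'
  classical
  -- `π` is an isomorphism over the complement `V` of the centre; `g := π|_(π⁻¹V)` is an open immersion
  let V : X₁.Opens := centreCompl J
  haveI hisoV : IsIso (π ∣_ V) := hπ.isIso_compl
  haveI hg : IsOpenImmersion ((π ⁻¹ᵁ V).ι ≫ π) := hπ.isOpenImmersion_preimage_compl_ι
  have hx'V : π.base x' ∈ V := hx'
  -- every point of `V` is hit exactly once
  have hinj : ∀ y z : X', π.base y ∈ V → π.base z ∈ V → π.base y = π.base z → y = z :=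
    fun y z hy hz h => BadMaximalPoints.eq_of_base_eq_of_isIso_morphismRestrict π V y z hy hz h
  -- the open `W := g (W' ∩ π⁻¹V)` of `X₁`
  let W : X₁.Opens := ((π ⁻¹ᵁ V).ι ≫ π) ''ᵁ ((π ⁻¹ᵁ V).ι ⁻¹ᵁ W')
  have hWdef : (W : Set X₁) = π.base '' {z : X' | π.base z ∈ V ∧ z ∈ W'} := by
    ext y
    constructor
    · rintro ⟨z, hz, rfl⟩
      exact ⟨z.1, ⟨z.2, hz⟩, by simp [Scheme.Hom.comp_base]⟩
    · rintro ⟨z, ⟨hzV, hzW⟩, rfl⟩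
      exact ⟨⟨z, hzV⟩, hzW, by simp [Scheme.Hom.comp_base]⟩
  have hxW : π.base x' ∈ W := by
    rw [← SetLike.mem_coe, hWdef]; exact ⟨x', ⟨hx'V, hxW'⟩, rfl⟩
  have hWV : (W : Set X₁) ⊆ V := by
    rw [hWdef]; rintro _ ⟨z, ⟨hzV, -⟩, rfl⟩; exact hzV
  -- a locally-fixable chart `U ≤ W` of `X₁` around `π x'`
  obtain ⟨U, hUW, hxU, halone, hchar, I, hI0, hzero, hloc⟩ := hP W hxW
  have hUV : (U : Set X₁) ⊆ (V : Set X₁) := fun y hy => hWV (hUW hy)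
  -- `π ∣_ U` is an isomorphism, so `U' := π⁻¹U` is an affine open of `X'` and `π^*` a ring isomorphism on sections
  have hdisj : Disjoint ((U : X₁.Opens) : Set X₁) (J.support : Set X₁) := by
    rw [Set.disjoint_left]; intro y hy hyJ; exact hUV hy hyJ
  haveI hisoU : IsIso (π ∣_ (U : X₁.Opens)) := hπ.isIso_morphismRestrict hdisj
  haveI : IsAffine (U : X₁.Opens) := U.2
  have hU'aff : IsAffineOpen (π ⁻¹ᵁ (U : X₁.Opens)) := IsAffine.of_isIso (π ∣_ (U : X₁.Opens))
  -- the ring isomorphism `e : Γ(X₁, U) ≃+* Γ(X', π⁻¹ U)`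
  have hUrange : (U : X₁.Opens) ≤ ((π ⁻¹ᵁ V).ι ≫ π).opensRange := by
    intro y hy
    obtain ⟨z, hz⟩ := BadMaximalPoints.exists_base_eq_of_isIso_morphismRestrict π V y (hUV hy)
    refine ⟨⟨z, show π.base z ∈ V from hz ▸ hUV hy⟩, ?_⟩
    simp [Scheme.Hom.comp_base, hz]
  haveI hiso_gapp : IsIso (((π ⁻¹ᵁ V).ι ≫ π).app (U : X₁.Opens)) := ((π ⁻¹ᵁ V).ι ≫ π).isIso_app _ hUrange
  have hUV' : π ⁻¹ᵁ (U : X₁.Opens) ≤ (π ⁻¹ᵁ V).ι.opensRange := by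
    rw [Scheme.Opens.opensRange_ι]; exact fun z hz => hUV hz
  haveI : IsIso ((π ⁻¹ᵁ V).ι.app (π ⁻¹ᵁ (U : X₁.Opens))) := (π ⁻¹ᵁ V).ι.isIso_app _ hUV'
  haveI hiso_app : IsIso (π.app (U : X₁.Opens)) := by
    have hcomp : ((π ⁻¹ᵁ V).ι ≫ π).app (U : X₁.Opens) =
        π.app (U : X₁.Opens) ≫ (π ⁻¹ᵁ V).ι.app (π ⁻¹ᵁ (U : X₁.Opens)) := Scheme.Hom.comp_app _ _ _
    haveI : IsIso (π.app (U : X₁.Opens) ≫ (π ⁻¹ᵁ V).ι.app (π ⁻¹ᵁ (U : X₁.Opens))) := hcomp ▸ hiso_gapp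
    exact IsIso.of_isIso_comp_right (π.app (U : X₁.Opens)) ((π ⁻¹ᵁ V).ι.app (π ⁻¹ᵁ (U : X₁.Opens)))
  let e : Γ(X₁, (U : X₁.Opens)) ≃+* Γ(X', π ⁻¹ᵁ (U : X₁.Opens)) := (asIso (π.app (U : X₁.Opens))).commRingCatIsoToRingEquiv
  let φ : Γ(X₁, (U : X₁.Opens)) →+* Γ(X', π ⁻¹ᵁ (U : X₁.Opens)) := (π.app (U : X₁.Opens)).hom
  have heφ : ∀ r, e r = φ r := fun r => rfl
  have hφinj : Function.Injective φ := fun a b h => e.injective (by rw [heφ, heφ]; exact h)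
  have hφsurj : Function.Surjective φ := fun b => by
    obtain ⟨a, ha⟩ := e.surjective b
    exact ⟨a, by rw [← heφ]; exact ha⟩
  -- the pieces of the new locally-fixable chart
  have hle : ((⟨π ⁻¹ᵁ (U : X₁.Opens), hU'aff⟩ : X'.affineOpens) : X'.Opens) ≤ W' := by
    intro z hz
    have hzU : π.base z ∈ (U : X₁.Opens) := hz
    have hzW : π.base z ∈ W := hUW hzU
    rw [← SetLike.mem_coe, hWdef] at hzW
    obtain ⟨z₀, ⟨hz₀V, hz₀W⟩, hzz⟩ := hzW
    rwa [← hinj z₀ z hz₀V (hUV hzU) hzz]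
  have halone' : ∀ z : X', z ∈ ((⟨π ⁻¹ᵁ (U : X₁.Opens), hU'aff⟩ : X'.affineOpens) : X'.Opens) → z ≠ x' → ∀ d : ℕ, ringKrullDim (X'.presheaf.stalk z) = d → ∀ s : Fin d → X'.presheaf.stalk z, (Ideal.span (Set.range s)).radical.IsMaximal → ∀ y : X'.presheaf.stalk z, (∃ e : ℕ, y ^ p ^ e ∈ Ideal.span ((fun z : X'.presheaf.stalk z => z ^ p ^ e) '' (Ideal.span (Set.range s) : Set (X'.presheaf.stalk z)))) → y ∈ Ideal.span (Set.range s) := by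
    intro z hz hne
    have hzU : π.base z ∈ (U : X₁.Opens) := hz
    have hne' : π.base z ≠ π.base x' := fun h => hne (hinj z x' (hUV hzU) hx'V h)
    exact (IsoLocusTransport.fClause_iff_of_isIso_morphismRestrict p π V z (hUV hzU)).mp (halone _ hzU hne')
  have hchar' : CharP Γ(X', ((⟨π ⁻¹ᵁ (U : X₁.Opens), hU'aff⟩ : X'.affineOpens) : X'.Opens)) p := by
    haveI := hchar
    exact charP_of_injective_ringHom (f := φ) hφinj p
  have hI0' : I.map φ ≠ ⊥ := fun h0 => hI0 ((Ideal.map_eq_bot_iff_of_injective hφinj).mp h0)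
  have hzero' : ∀ (z : X') (hz : z ∈ ((⟨π ⁻¹ᵁ (U : X₁.Opens), hU'aff⟩ : X'.affineOpens) : X'.Opens)),
      I.map φ ≤ (hU'aff.primeIdealOf ⟨z, hz⟩).asIdeal ↔ z = x' := by
    intro z hz
    have hzU : π.base z ∈ (U : X₁.Opens) := hz
    have hcomap := IsAffineOpen.comap_primeIdealOf_appLE (f := π) (x := z) (U : X₁.Opens) U.2
      (π ⁻¹ᵁ (U : X₁.Opens)) hU'aff le_rfl hz
    rw [Scheme.Hom.appLE_eq_app] at hcomap
    have hc : Ideal.comap φ (hU'aff.primeIdealOf ⟨z, hz⟩).asIdeal = (U.2.primeIdealOf ⟨π.base z, hzU⟩).asIdeal :=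
      congrArg PrimeSpectrum.asIdeal hcomap
    rw [Ideal.map_le_iff_le_comap, hc, hzero (π.base z) hzU]
    exact ⟨fun h => hinj z x' (hUV hzU) hx'V h, fun h => by rw [h]⟩
  -- the local blow-up clause along `e`
  have hloc' := affineBlowupClause_transport p X₁ X' π U hU'aff ⟨hφinj, hφsurj⟩ I x' hloc
  exact ⟨⟨π ⁻¹ᵁ (U : X₁.Opens), hU'aff⟩, hle, hxU, halone', hchar', I.map φ, hI0', hzero', hloc'⟩

/-! ## §5d Certified charts are locally fixable -/

/-- **§5d — CERTIFIED CHARTS ARE LOCALLY FIXABLE** (`P_cert ⇒ P_loc` on admissible pairs): on a certified chart `U ∋ b`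
(`I ≠ 0` with zero locus `{b}`, a covering family `v` of `I` with certified affine blow-up algebras, E6‴ format) of an integral,
everywhere Cohen–Macaulay `X₁` on which `b` is the only bad point, EVERY stalk of `Bl_I(U)` satisfies the full clause (§2a
`CertifiedChartCentre.affineBlowupStalkClauseOfCover`; its «off `V(I)`» input is the clause off `b` on `U` read at ring level,
`clauseOff_of_zeroLocus`). [folklore] -/
theorem certifiedChart_locallyFixable : ∀ (p : ℕ), p.Prime → ∀ (k : Type) [Field k] [CharP k p]
    (X₁ : Scheme.{0}) (f₁ : X₁ ⟶ Spec (.of k)),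
      IsSeparated f₁ → LocallyOfFiniteType f₁ → QuasiCompact f₁ → IsIntegral X₁ →
      (∀ x : X₁, ∀ d : ℕ, ringKrullDim (X₁.presheaf.stalk x) = d → ∀ s : Fin d → X₁.presheaf.stalk x, (Ideal.span (Set.range s)).radical.IsMaximal → RingTheory.Sequence.IsWeaklyRegular (X₁.presheaf.stalk x) (List.ofFn s)) →
      Set.Finite {x : X₁ | ¬ ∀ d : ℕ, ringKrullDim (X₁.presheaf.stalk x) = d → ∀ s : Fin d → X₁.presheaf.stalk x, (Ideal.span (Set.range s)).radical.IsMaximal → ∀ y : X₁.presheaf.stalk x, (∃ e : ℕ, y ^ p ^ e ∈ Ideal.span ((fun z : X₁.presheaf.stalk x => z ^ p ^ e) '' (Ideal.span (Set.range s) : Set (X₁.presheaf.stalk x)))) → y ∈ Ideal.span (Set.range s)} →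
      ∀ b : X₁, (∀ W : X₁.Opens, b ∈ W → ∃ U : X₁.affineOpens, (U : X₁.Opens) ≤ W ∧ b ∈ (U : X₁.Opens) ∧
        (∀ x : X₁, x ∈ (U : X₁.Opens) → x ≠ b → ∀ d : ℕ, ringKrullDim (X₁.presheaf.stalk x) = d → ∀ s : Fin d → X₁.presheaf.stalk x, (Ideal.span (Set.range s)).radical.IsMaximal → ∀ y : X₁.presheaf.stalk x, (∃ e : ℕ, y ^ p ^ e ∈ Ideal.span ((fun z : X₁.presheaf.stalk x => z ^ p ^ e) '' (Ideal.span (Set.range s) : Set (X₁.presheaf.stalk x)))) → y ∈ Ideal.span (Set.range s)) ∧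
        CharP Γ(X₁, U) p ∧ ∃ (I : Ideal Γ(X₁, U)), I ≠ ⊥ ∧
        (∀ (x : X₁) (hx : x ∈ (U : X₁.Opens)), I ≤ (U.2.primeIdealOf ⟨x, hx⟩).asIdeal ↔ x = b) ∧
        ∃ (t : ℕ) (v : Fin t → Γ(X₁, U)) (hv : ∀ j : Fin t, v j ∈ I),
          (HomogeneousIdeal.irrelevant (reesGrading I)).toIdeal ≤ (Ideal.span (Set.range fun j : Fin t => reesT (I := I) (v j) (hv j))).radical ∧
          (∀ j : Fin t, v j ≠ 0) ∧
          ∀ (j : Fin t) (Q : Ideal (Literature.AlgebraicGeometry.Resolution.blowupAlgebra I (v j))) [Q.IsMaximal],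
            algebraMap Γ(X₁, U) (Literature.AlgebraicGeometry.Resolution.blowupAlgebra I (v j)) (v j) ∈ Q →
            ∀ d : ℕ, ringKrullDim (Localization.AtPrime Q) = d → ∀ s : Fin d → Localization.AtPrime Q, (Ideal.span (Set.range s)).radical.IsMaximal → RingTheory.Sequence.IsWeaklyRegular (Localization.AtPrime Q) (List.ofFn s) ∧ ∀ y : Localization.AtPrime Q, (∃ e : ℕ, y ^ p ^ e ∈ Ideal.span ((fun z : Localization.AtPrime Q => z ^ p ^ e) '' (Ideal.span (Set.range s) : Set (Localization.AtPrime Q)))) → y ∈ Ideal.span (Set.range s)) →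
      (∀ W : X₁.Opens, b ∈ W → ∃ U : X₁.affineOpens, (U : X₁.Opens) ≤ W ∧ b ∈ (U : X₁.Opens) ∧
        (∀ x : X₁, x ∈ (U : X₁.Opens) → x ≠ b → ∀ d : ℕ, ringKrullDim (X₁.presheaf.stalk x) = d → ∀ s : Fin d → X₁.presheaf.stalk x, (Ideal.span (Set.range s)).radical.IsMaximal → ∀ y : X₁.presheaf.stalk x, (∃ e : ℕ, y ^ p ^ e ∈ Ideal.span ((fun z : X₁.presheaf.stalk x => z ^ p ^ e) '' (Ideal.span (Set.range s) : Set (X₁.presheaf.stalk x)))) → y ∈ Ideal.span (Set.range s)) ∧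
        CharP Γ(X₁, U) p ∧ ∃ (I : Ideal Γ(X₁, U)), I ≠ ⊥ ∧
        (∀ (x : X₁) (hx : x ∈ (U : X₁.Opens)), I ≤ (U.2.primeIdealOf ⟨x, hx⟩).asIdeal ↔ x = b) ∧
        ∀ y : ↥(affineBlowup I), (affineBlowup.π I ≫ U.2.fromSpec).base y = b →
          IsDomain ((affineBlowup I).presheaf.stalk y) ∧ ∀ d : ℕ, ringKrullDim ((affineBlowup I).presheaf.stalk y) = d → ∀ s : Fin d → (affineBlowup I).presheaf.stalk y, (Ideal.span (Set.range s)).radical.IsMaximal → RingTheory.Sequence.IsWeaklyRegular ((affineBlowup I).presheaf.stalk y) (List.ofFn s) ∧ ∀ z : (affineBlowup I).presheaf.stalk y, (∃ e : ℕ, z ^ p ^ e ∈ Ideal.span ((fun w : (affineBlowup I).presheaf.stalk y => w ^ p ^ e) '' (Ideal.span (Set.range s) : Set ((affineBlowup I).presheaf.stalk y)))) → z ∈ Ideal.span (Set.range s)) := by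
  intro p hp k _ _ X₁ f₁ _ hft hqc hint hCM _ b hP W hbW
  haveI : Fact p.Prime := ⟨hp⟩
  haveI : IsNoetherian X₁ := ClosedPointsOfClosedFinite.isNoetherian_of_locallyOfFiniteType_of_quasiCompact f₁
  obtain ⟨U, hUW, hbU, halone, hchar, I, hI0, hzero, t, v, hv, hcov, hv0, hcharts⟩ := hP W hbW
  refine ⟨U, hUW, hbU, halone, hchar, I, hI0, hzero, fun y _ => ?_⟩
  haveI : Nonempty (U : X₁.Opens) := ⟨⟨b, hbU⟩⟩
  haveI : IsDomain Γ(X₁, U) := IsIntegral.component_integral (U : X₁.Opens)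
  haveI : IsNoetherianRing Γ(X₁, U) := IsLocallyNoetherian.component_noetherian U
  haveI : CharP Γ(X₁, U) p := hchar
  have hoff' := clauseOff_of_zeroLocus p X₁ U I b hzero fun x hxU hxb =>
    ⟨inferInstance, fun d hd s hs => ⟨hCM x d hd s hs, halone x hxU hxb d hd s hs⟩⟩
  exact CertifiedChartCentre.affineBlowupStalkClauseOfCover p Γ(X₁, U) I t v hv hI0 hv0 hcov
    (fun P _ hIP => hoff' P hIP) hcharts y

/-! ## §5cα THEOREM A-locα -/

/-- **§5cα — THEOREM A-locα: F-INJECTIVE MACAULAYFICATION ON THE LOCALLY-FIXABLE CLASS** (composition, PROVED from the landed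
G-β-rel `SequentialSurgeryGlueOfClass.sequentialSurgeryGlueOfClass` (p505685) + §5aα + §5bα; ruling R11.14): every admissible pair
`(X₁, f₁)` (separated, locally of finite type, quasi-compact over `k` of characteristic `p`, integral, all local rings
Cohen–Macaulay, finite bad set) ALL OF WHOSE BAD POINTS ARE LOCALLY FIXABLE (`P_locα`) has a proper birational model whose stalks
are domains, Cohen–Macaulay, with all parameter ideals Frobenius closed. Zero named facts; no certificate format; no engine.
[folklore] -/
theorem fInjectiveMacaulayfication_of_locallyFixable (p : ℕ) (hp : p.Prime) (k : Type) [Field k] [CharP k p]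
    (X₁ : Scheme.{0}) (f₁ : X₁ ⟶ Spec (.of k)) (hsep : IsSeparated f₁) (hft : LocallyOfFiniteType f₁) (hqc : QuasiCompact f₁)
    (hint : IsIntegral X₁) (hCM : ∀ x : X₁, ∀ d : ℕ, ringKrullDim (X₁.presheaf.stalk x) = d → ∀ s : Fin d → X₁.presheaf.stalk x, (Ideal.span (Set.range s)).radical.IsMaximal → RingTheory.Sequence.IsWeaklyRegular (X₁.presheaf.stalk x) (List.ofFn s))
    (hfin : Set.Finite {x : X₁ | ¬ ∀ d : ℕ, ringKrullDim (X₁.presheaf.stalk x) = d → ∀ s : Fin d → X₁.presheaf.stalk x, (Ideal.span (Set.range s)).radical.IsMaximal → ∀ y : X₁.presheaf.stalk x, (∃ e : ℕ, y ^ p ^ e ∈ Ideal.span ((fun z : X₁.presheaf.stalk x => z ^ p ^ e) '' (Ideal.span (Set.range s) : Set (X₁.presheaf.stalk x)))) → y ∈ Ideal.span (Set.range s)})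
    (hcl : ∀ b : X₁, (¬ ∀ d : ℕ, ringKrullDim (X₁.presheaf.stalk b) = d → ∀ s : Fin d → X₁.presheaf.stalk b, (Ideal.span (Set.range s)).radical.IsMaximal → ∀ y : X₁.presheaf.stalk b, (∃ e : ℕ, y ^ p ^ e ∈ Ideal.span ((fun z : X₁.presheaf.stalk b => z ^ p ^ e) '' (Ideal.span (Set.range s) : Set (X₁.presheaf.stalk b)))) → y ∈ Ideal.span (Set.range s)) →
      (∀ W : X₁.Opens, b ∈ W → ∃ U : X₁.affineOpens, (U : X₁.Opens) ≤ W ∧ b ∈ (U : X₁.Opens) ∧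
        (∀ x : X₁, x ∈ (U : X₁.Opens) → x ≠ b → ∀ d : ℕ, ringKrullDim (X₁.presheaf.stalk x) = d → ∀ s : Fin d → X₁.presheaf.stalk x, (Ideal.span (Set.range s)).radical.IsMaximal → ∀ y : X₁.presheaf.stalk x, (∃ e : ℕ, y ^ p ^ e ∈ Ideal.span ((fun z : X₁.presheaf.stalk x => z ^ p ^ e) '' (Ideal.span (Set.range s) : Set (X₁.presheaf.stalk x)))) → y ∈ Ideal.span (Set.range s)) ∧
        CharP Γ(X₁, U) p ∧ ∃ (I : Ideal Γ(X₁, U)), I ≠ ⊥ ∧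
        (∀ (x : X₁) (hx : x ∈ (U : X₁.Opens)), I ≤ (U.2.primeIdealOf ⟨x, hx⟩).asIdeal ↔ x = b) ∧
        ∀ y : ↥(affineBlowup I), (affineBlowup.π I ≫ U.2.fromSpec).base y = b →
          IsDomain ((affineBlowup I).presheaf.stalk y) ∧ ∀ d : ℕ, ringKrullDim ((affineBlowup I).presheaf.stalk y) = d → ∀ s : Fin d → (affineBlowup I).presheaf.stalk y, (Ideal.span (Set.range s)).radical.IsMaximal → RingTheory.Sequence.IsWeaklyRegular ((affineBlowup I).presheaf.stalk y) (List.ofFn s) ∧ ∀ z : (affineBlowup I).presheaf.stalk y, (∃ e : ℕ, z ^ p ^ e ∈ Ideal.span ((fun w : (affineBlowup I).presheaf.stalk y => w ^ p ^ e) '' (Ideal.span (Set.range s) : Set ((affineBlowup I).presheaf.stalk y)))) → z ∈ Ideal.span (Set.range s))) :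
    ∃ (X' : Scheme.{0}) (π : X' ⟶ X₁), IsProper π ∧ Literature.AlgebraicGeometry.Resolution.IsBirational π ∧
      ∀ x : X', IsDomain (X'.presheaf.stalk x) ∧ ∀ d : ℕ, ringKrullDim (X'.presheaf.stalk x) = d → ∀ s : Fin d → X'.presheaf.stalk x, (Ideal.span (Set.range s)).radical.IsMaximal → RingTheory.Sequence.IsWeaklyRegular (X'.presheaf.stalk x) (List.ofFn s) ∧ ∀ y : X'.presheaf.stalk x, (∃ e : ℕ, y ^ p ^ e ∈ Ideal.span ((fun z : X'.presheaf.stalk x => z ^ p ^ e) '' (Ideal.span (Set.range s) : Set (X'.presheaf.stalk x)))) → y ∈ Ideal.span (Set.range s) :=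
  SequentialSurgeryGlueOfClass.sequentialSurgeryGlueOfClass p hp k
    (fun X₁ _ b => (∀ W : X₁.Opens, b ∈ W → ∃ U : X₁.affineOpens, (U : X₁.Opens) ≤ W ∧ b ∈ (U : X₁.Opens) ∧
        (∀ x : X₁, x ∈ (U : X₁.Opens) → x ≠ b → ∀ d : ℕ, ringKrullDim (X₁.presheaf.stalk x) = d → ∀ s : Fin d → X₁.presheaf.stalk x, (Ideal.span (Set.range s)).radical.IsMaximal → ∀ y : X₁.presheaf.stalk x, (∃ e : ℕ, y ^ p ^ e ∈ Ideal.span ((fun z : X₁.presheaf.stalk x => z ^ p ^ e) '' (Ideal.span (Set.range s) : Set (X₁.presheaf.stalk x)))) → y ∈ Ideal.span (Set.range s)) ∧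
        CharP Γ(X₁, U) p ∧ ∃ (I : Ideal Γ(X₁, U)), I ≠ ⊥ ∧
        (∀ (x : X₁) (hx : x ∈ (U : X₁.Opens)), I ≤ (U.2.primeIdealOf ⟨x, hx⟩).asIdeal ↔ x = b) ∧
        ∀ y : ↥(affineBlowup I), (affineBlowup.π I ≫ U.2.fromSpec).base y = b →
          IsDomain ((affineBlowup I).presheaf.stalk y) ∧ ∀ d : ℕ, ringKrullDim ((affineBlowup I).presheaf.stalk y) = d → ∀ s : Fin d → (affineBlowup I).presheaf.stalk y, (Ideal.span (Set.range s)).radical.IsMaximal → RingTheory.Sequence.IsWeaklyRegular ((affineBlowup I).presheaf.stalk y) (List.ofFn s) ∧ ∀ z : (affineBlowup I).presheaf.stalk y, (∃ e : ℕ, z ^ p ^ e ∈ Ideal.span ((fun w : (affineBlowup I).presheaf.stalk y => w ^ p ^ e) '' (Ideal.span (Set.range s) : Set ((affineBlowup I).presheaf.stalk y)))) → z ∈ Ideal.span (Set.range s)))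
    (locallyFixable_transport p hp k) (locallyFixable_h4 p hp k)
    X₁ f₁ hsep hft hqc hint hCM hfin hcl

end Summit.ResolutionOfSingularities.ResolutionOfSingularities.Theorems.FInjectiveMacaulayfication.LocallyFixable

end
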